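import Summits.ResolutionOfSingularities.ResolutionOfSingularities.Theorems.HilbertSamuelEliminationSigmaMaxModificationsCorridor3WLadderStrataBirths
import Summits.ResolutionOfSingularities.ResolutionOfSingularities.Theorems.HilbertSamuelEliminationSigmaMaxModificationsCorridor3WLadderBirthDefs
import HarnessLib

/-!
# [OURS · L1 W4.2] `Corridor3WLadderStrataBirthsTopDictionary` — part 1: the BIRTH EVENTS of row (b-end) and its split into
# «no late FIBRE births» ∧ «no late MOVING births» (proved join)

Crux chain w42 (`SigmaMaxModifications`, stmt-ResolutionOfSingularities-18506; conjunct `SigmaMaxModificationsCorridor3`,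
stmt-ResolutionOfSingularities-19249), object «BIRTH DICTIONARY (b)₃» (res-L1-w42-plan-1 g9 07:52:17Z → res-type-067; PACE #1 = CUT
07:58:12Z; RULINGS v3.12-1 (C) 08:12:41Z: «(α) for part 1 — FILE (B) NOW as part 1 … Part 2 RE-CUT (centre dimension)»). Typer
res-type-067 (gen 11). OURS (cell res-hironaka, slot W4.2); NOT statements of H. Hironaka's manuscript [Hironaka2017] nor of
[CossartJannsenSaito2020]; AI-typed, weaker than expert review. Helper file `--supports stmt-ResolutionOfSingularities-19249 --as helper`
(counted 0). Every `theorem` is PROVED; the open content is the two `def … : Prop` rows.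

WHY A SPLIT (PACE #1 finding (A), confirmed by plan-1 and res-D-pv-002): the literal dictionary «newborn component ↦ a near direction
`[b]` with `VanishesToOrder (in_{d_i} c_i) b̂ (2(m−i) − d_i)`» is satisfied by EVERY `κ`-rational near point (002's T1 = `birthNear`,
p512089), and the chain point `x_{n+1}` is near at every genuine step — so «eventually no such datum» is false on every infinite moving
chain and «eventually no newborn component» is row (b-end) itself. A usable dictionary must carry a BIRTH SIGNATURE, and the signature
depends on WHERE the newborn component lies relative to the fibre over `x_n`:

* `IsNewbornAt N ν s s' f Z'` — `Z'` is an irreducible component of `X_{n+1}(ν)` through `x_{n+1}` NOT dominating a component of `X_n(ν)`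
  (the negation of (b-end)'s conclusion for `Z'`);
* `IsFibreBirthAt` — newborn with image closure `{x_n}`: a positive-dimensional family of near points of `x_n` through `x_{n+1}` inside
  `ℙ(Dir_{x_n}/T_{x_n}D)` — the only event a GRADED READING AT `x_n` can see;
* `IsMovingBirthAt` — newborn with positive-dimensional image closure (inside the centre, by stub-4's
  `StepProjection.subset_preimage_support_of_not_mem`, …WLadderStrataBirths §1) — invisible to every pointwise graded datum of `x_n`
  (object D13, RULINGS v3.12-1 (D): generic-point localisation one storey up);
* `IsNewbornAt.fibre_or_moving` (case split, proved);
* rows `StrataCycleEndNoFibreBirths p N Q G` / `StrataCycleEndNoMovingBirths p N Q G` in the exact shape of stub-4's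
  `StrataCycleEndBirthsSettle` (…WLadderStrataBirths.lean:175) with conclusions `∀ Z', ¬ IsFibreBirthAt …` / `¬ IsMovingBirthAt …`;
* `strataCycleEndBirthsSettle_of_noFibre_noMoving : NoFibre → NoMoving → StrataCycleEndBirthsSettle p N Q G` — PROVED (8 lines).

STEP GEOMETRY OF RECORD (PACE #2 08:12:03Z = RULINGS v3.12-1 (C)): at the steps the row constrains — blown-up CYCLE-END steps of
NEVER-ISOLATED chains — the centre is the whole treated part `Y_n^{(j)}` (`support_eq_part_of_next_none`) and its piece through `x_n` is a
regular CURVE or SURFACE, never `{x_n}`; over a surface there is no fibre birth (`ℙ(Dir/T_S) = ℙ⁰` at `ē = 3`), over a curve a fibre birth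
is «`ℙ(Dir/T_D) ≅ ℙ¹` wholly near». Part 2 (`…StrataBirthsTopDictionaryGraded`, after 002's word on the curve-blow-up charts) types
the CURVE-centre graded dictionary `BirthDictionary3`, the re-aimed OURS claim `NoRecurrentFibreBirth3`, the point-centre datum
`NearCurveDatumPt` / `BirthDictionary3Pt` for REPLAY-step births, and `not_isFibreBirthAt_of_surface_centre`.
-/

noncomputable section

set_option linter.dupNamespace false

open CategoryTheory AlgebraicGeometry TopologicalSpace Topology
open Summit.ResolutionOfSingularities.ResolutionOfSingularities.Theorems.CampaignW42
open Literature.AlgebraicGeometry.Resolution Literature.RingTheory.HilbertSamuel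
open Summit.ResolutionOfSingularities.ResolutionOfSingularities.Theorems.SigmaMaxModificationsCorridor3

namespace Summit.ResolutionOfSingularities.ResolutionOfSingularities.Theorems.SigmaMaxModificationsCorridor3.Moving

universe u

variable {R : ∀ S : Scheme.{u}, CentreSeq S → Prop} {N : ℕ} {ν : ℕ → ℕ}

/-- [OURS · L1 W4.2] **NEWBORN component at a step**: an irreducible component `Z'` of `X_{n+1}(ν)` through `x_{n+1}` which does NOT
dominate a component of `X_n(ν)` along the blow-down `f` (the negation of row (b-end)'s conclusion for `Z'`). [folklore] -/
def IsNewbornAt (N : ℕ) (ν : ℕ → ℕ) (s s' : MarkedStage.{u}) (f : s'.W ⟶ s.W) (Z' : Set s'.W) : Prop :=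
  Z' ∈ componentsThrough N ν s' ∧ closure (f.base '' Z') ∉ componentsIn (Scheme.hsStratum s.W N ν)

/-- [OURS · L1 W4.2] **FIBRE BIRTH**: a newborn component through `x_{n+1}` lying in the fibre over `x_n` (its image closure is
`{x_n}`) — a positive-dimensional family of near points of `x_n` through `x_{n+1}` inside `ℙ(Dir_{x_n}/T_{x_n}D)`; the event the
GRADED birth law of `x_n` (idea-1 C3 §8, `Birth.BirthNear` / 002's `Birth.vanishesToOrder_initialForm_of_near`) speaks about. [folklore] -/
def IsFibreBirthAt (N : ℕ) (ν : ℕ → ℕ) (s s' : MarkedStage.{u}) (f : s'.W ⟶ s.W) (Z' : Set s'.W) : Prop :=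
  IsNewbornAt N ν s s' f Z' ∧ closure (f.base '' Z') = {s.pt}

/-- [OURS · L1 W4.2] **MOVING BIRTH**: a newborn component through `x_{n+1}` whose image closure is a positive-dimensional proper
closed subset through `x_n` (inside the centre, by `StepProjection.subset_preimage_support_of_not_mem`) — NOT a fibre phenomenon at
`x_n`; no pointwise graded reading of `x_n` sees it. [folklore] -/
def IsMovingBirthAt (N : ℕ) (ν : ℕ → ℕ) (s s' : MarkedStage.{u}) (f : s'.W ⟶ s.W) (Z' : Set s'.W) : Prop :=
  IsNewbornAt N ν s s' f Z' ∧ closure (f.base '' Z') ≠ {s.pt}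

/-- A newborn component is a fibre birth or a moving birth (case split, proved). [folklore] -/
theorem IsNewbornAt.fibre_or_moving {s s' : MarkedStage.{u}} {f : s'.W ⟶ s.W} {Z' : Set s'.W}
    (h : IsNewbornAt N ν s s' f Z') : IsFibreBirthAt N ν s s' f Z' ∨ IsMovingBirthAt N ν s s' f Z' := by
  by_cases hc : closure (f.base '' Z') = {s.pt}
  · exact Or.inl ⟨h, hc⟩
  · exact Or.inr ⟨h, hc⟩

/-- [OURS · L1 W4.2] **ROW «NO LATE FIBRE BIRTHS»** in the shape of `StrataCycleEndBirthsSettle`: along every moving, never-isolated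
`G`-chain from a `Q`-maximal origin, from some stage on no blown-up cycle-end step has a FIBRE birth through the chain point. [folklore] -/
def StrataCycleEndNoFibreBirths (p N : ℕ) (Q : ℕ → (ℕ → ℕ) → ∀ X : Scheme.{u}, X → Prop) (G : MarkedStage.{u} → Prop) : Prop :=
  ∀ (R : ∀ S : Scheme.{u}, CentreSeq S → Prop), OracleFunctional R → OracleAdmissible R →
  ∀ (ν : ℕ → ℕ) (X : Scheme.{u}) [IsLocallyNoetherian X] (x : X), IsMaximalOrigin p N ν X x → Q N ν X x →
  ∀ c : ℕ → MarkedStage.{u}, Reaches R N ν (MarkedStage.init X x) (c 0) →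
    (∀ n, CanonicalNearStep R N ν (c n) (c (n + 1))) → (∀ n, G (c n)) → (∀ n, ¬ Iso N (c n)) →
    (∀ n, ∃ m, n ≤ m ∧ (c m).IsBlownUp R N ν) →
    ∃ n₁, ∀ n, n₁ ≤ n → (c n).IsBlownUp R N ν → (c (n + 1)).P = none →
      ∀ f : (c (n + 1)).W ⟶ (c n).W, StepProjection R N ν (c n) (c (n + 1)) f →
        ∀ Z', ¬ IsFibreBirthAt N ν (c n) (c (n + 1)) f Z'

/-- [OURS · L1 W4.2] **ROW «NO LATE MOVING BIRTHS»** (same shape). [folklore] -/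
def StrataCycleEndNoMovingBirths (p N : ℕ) (Q : ℕ → (ℕ → ℕ) → ∀ X : Scheme.{u}, X → Prop) (G : MarkedStage.{u} → Prop) : Prop :=
  ∀ (R : ∀ S : Scheme.{u}, CentreSeq S → Prop), OracleFunctional R → OracleAdmissible R →
  ∀ (ν : ℕ → ℕ) (X : Scheme.{u}) [IsLocallyNoetherian X] (x : X), IsMaximalOrigin p N ν X x → Q N ν X x →
  ∀ c : ℕ → MarkedStage.{u}, Reaches R N ν (MarkedStage.init X x) (c 0) →
    (∀ n, CanonicalNearStep R N ν (c n) (c (n + 1))) → (∀ n, G (c n)) → (∀ n, ¬ Iso N (c n)) →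
    (∀ n, ∃ m, n ≤ m ∧ (c m).IsBlownUp R N ν) →
    ∃ n₁, ∀ n, n₁ ≤ n → (c n).IsBlownUp R N ν → (c (n + 1)).P = none →
      ∀ f : (c (n + 1)).W ⟶ (c n).W, StepProjection R N ν (c n) (c (n + 1)) f →
        ∀ Z', ¬ IsMovingBirthAt N ν (c n) (c (n + 1)) f Z'

/-- **(b-end) from the two halves (proved composition)**: no late fibre births ∧ no late moving births ⇒ `StrataCycleEndBirthsSettle`.
[folklore] -/
theorem strataCycleEndBirthsSettle_of_noFibre_noMoving {p N : ℕ} {Q : ℕ → (ℕ → ℕ) → ∀ X : Scheme.{u}, X → Prop}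
    {G : MarkedStage.{u} → Prop} (hF : StrataCycleEndNoFibreBirths p N Q G) (hM : StrataCycleEndNoMovingBirths p N Q G) :
    StrataCycleEndBirthsSettle p N Q G := by
  intro R hRf hRa ν X _ x hX hQ c h0 hstep hG hnI hmov
  obtain ⟨n₁, hn₁⟩ := hF R hRf hRa ν X x hX hQ c h0 hstep hG hnI hmov
  obtain ⟨n₂, hn₂⟩ := hM R hRf hRa ν X x hX hQ c h0 hstep hG hnI hmov
  refine ⟨max n₁ n₂, fun n hn hbu hP f hf Z' hZ' => ?_⟩
  by_contra hnot
  have hnew : IsNewbornAt N ν (c n) (c (n + 1)) f Z' := ⟨hZ', hnot⟩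
  rcases hnew.fibre_or_moving with hfi | hmo
  · exact hn₁ n (le_of_max_le_left hn) hbu hP f hf Z' hfi
  · exact hn₂ n (le_of_max_le_right hn) hbu hP f hf Z' hmo

end Summit.ResolutionOfSingularities.ResolutionOfSingularities.Theorems.SigmaMaxModificationsCorridor3.Moving

end
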